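/-
Copyright (c) 2026 the pub-hodgecm-mathlib formalisation cell (harness21).  Prover seat hodgecm-mathlib-A-p16 (g32): road «S3-ram» (LEAD F0P3a-plan (g12 → g13); owner∕table
F0P3a-p06 (g15)), the (a2) JUNCTION (J★) of F0P3a-p01 (g17) — organ «(J★) HEAD modulo the CONFIGURATION COUNTS» (A-p16 (g32); p01 «=» 01:50:26Z (3); ref5 R-356),
FILE 2 of 2: the head's signed identity in the EQUILATERAL configuration from the pen's engine statement; 2026-09-02.
-/
import Literature.NumberTheory.Rogawski1990.DepthZeroKappaTransferTypeOneRamifiedRootLineCountsLattice   -- FILE 1 (this seat, p847677)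
import Literature.NumberTheory.Automorphic.UnitaryLatticeTreeTypeOneLiteralFrames                      -- ★ p847627 (F0P3a-p05 (g17)): frames of the four literals
import Literature.NumberTheory.Automorphic.UnitaryLatticeTreeCentralRescalingCountTransport             -- ★ p847541 (F0P3a-p05 (g17)): D→J₀ transport
import Literature.NumberTheory.Automorphic.UnitaryLatticeTreeDiagonalLiteralAntidiagonalModel           -- ★ p847564 (F0P3a-p05 (g17)): the `u`-normalised literal in `U(J₀) ∩ GL₃(𝒪)`
import Literature.NumberTheory.Rogawski1990.DepthZeroKappaTransferTypeOneRamifiedRootTwists            -- ★ (F0P3a-p01 (g16)): `signedSum_card_rootNull_twists`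
import Literature.NumberTheory.Rogawski1990.DepthZeroKappaTransferTypeOneRamifiedRootClassSplit        -- ★ (F0P3a-p02∕p01): `signedSum_card_rootClass_twists`
import Literature.NumberTheory.Rogawski1990.DepthZeroKappaTransferTypeOneRamifiedKappaSumEquilateral   -- ★ J8-eq p847371 (F0P3a-p01 (g16)): `kappaSum_equilateral_eq`, `shellSum_P_pos_add_neg_{flip,keep}`
import HarnessLib


/-!
# The ramified type-(1) `κ`-orbital integral: THE JUNCTION HEAD FROM THE PER-LITERAL STRATA COUNTS — equilateral configuration (Rogawski 1990 §4.9; Kottwitz 1986 §3;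
# Labesse–Langlands 1979 §2)

Topic `NumberTheory/Rogawski1990`; namespace `Literature.NumberTheory.Rogawski1990`.  THEOREMS ONLY (no definition, no instance, no notation, no named fact, no `sorry`); kernel
lane `--supports stmt-HodgeConjecture-24833`; datum-free over the abstract lattice model (`K : Type` with `Valued K ℤᵐ⁰`, involution `σ` with `σϖ = −ϖ`, residually trivial,
finite residue field).  Cell `pub/hodgecm-mathlib` (D-0151), crux H413; road «S3-ram» (Literature seeding, count-neutral), fold of record v7.7 (LEAD T11-94) socket (J★) :164
`stub_typeOne_junction_ram` = the `hJ` hypothesis type of ★ p847532 `typeOne_signedClassSum_ram_of_junction`; junction pen F0P3a-p01 (g17), J-PACK v2 (03ef5f1f), skeleton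
v4 (e89e5e06) … v7 (326c2913).  ORGAN «(J★) HEAD modulo the CONFIGURATION COUNTS» (J-PACK v2 §3 items «COUNT TRANSPORT to the D-head · κ-SUM over the four literals · SIGN»;
A-p16 (g32) bid 01:34:50Z, sf v1 b826c99b, p01 «= — go» 01:50:26Z (3), ref5 R-356 «=»), FILE 2: the theorem
**`signedStrataCount_typeOne_ram_equilateral_of_strataCount`** takes the pen's ENGINE STATEMENT for one literal in the `J₀`-model, equilateral configuration — skeleton v4 :486
(≡ v5 :559 ≡ v6∕v7 :764) `strataCount_J₀_equilateral`, ∀-closed VERBATIM as the hypothesis `hEq` (sliced programmatically; its two instance binders `[ValuativeRel K]`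
`[(Valued.v).Compatible]` are synthesised at the call site by `ValuativeRel.ofValuation` ∕ `Valuation.Compatible.ofValuation`, ref5 R-335) — and proves the (J★) head's signed
identity (binders and conclusion = ★ p847532's `hJ` telescope VERBATIM, sliced from the tree file) for every type-(1) datum in the EQUILATERAL configuration
`hconf : N₁ = N ∧ N₂ = N` (then `m = N = 2n+1`, engine index `k = n − 1`).  THE CHAIN, per literal `b : Fin 2 × Fin 2`: the integral antidiagonal frame `A_b` of
`d_b = (ε^b₁u₀, ε^b₂u₁, ε^(b₁+b₂)u₂)` (★ p847627 `exists_frame_literalDiag`, F0P3a-p05) → the `u`-normalised literal `γ′_b = A_b·diag(α∕u, 1, γ∕u)·A_b⁻¹ ∈ U(σ, J₀) ∩ GL₃(𝒪)` (★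
p847564 `exists_mem_unitaryInt_coe_eq_conj_diagonal_div`, depths ★ `v_spectrum_div_sub`) → the D→J₀ transport of the five head counts (★ p847541
`ncard_strata_diagonal_eq_ncard_strata_antidiagonal_of_central`, `T″ = A_b⁻¹γ′_bA_b`, class constant `c₁ = (−det diag d_b)⁻¹·c₀`) → `hEq` (closed forms in `q`, `k`, `νE_b
νP_b νM_b`) → the three root line counts in chart currency (FILE 1 ★ p847677 `ncard_rootNullLines_eq_card_filter` ∕ `card_sub_one_mul_ncard_rootClassLines_eq_card_filter`
with leading coefficients `t = (A∕u, 0, C∕u)`; the class constants `−c₁`, `−(c₁ε)` of all four literals read the COMMON residual constant `−c̄₀⁻¹`, resp. its `ε̄⁻¹`-twist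
flipped to `χ = −1`); then, summing over `b` with the signs `(−1)^b₂`: ★ `signedSum_card_rootNull_twists` (`Σ κ_b νE_b = 4χ₀`) and ★ `signedSum_card_rootClass_twists`
(`(q−1)·Σ κ_b νP_b = (q−1)·Σ κ_b νM_b = −2(q−1)χ₀`), `χ₀ = χ(−ū₀ū₂·(Ā∕ū)(C̄∕ū)) = χ((−1)^m·ū₀ū₂ĀC̄)` (`m` odd, `ū⁻²` a square), and the algebra ★ J8-eq
`kappaSum_equilateral_eq q (n−1)` with ★ `shellSum_P_pos_add_neg_{keep,flip}` (both `IsSquare (−1)` branches), assembled by `linear_combination` over the four literals.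
The ISOCELES configurations (`N₁ = N₂ < N`: `u` isolated; `N₁ ≠ N₂`: `α` or `γ` isolated) are sibling theorems over the pen's iso engine statements (skeleton S1–S3 + S45,
★ J8-iso) in a sequel; the three together give the (J★) text by the trichotomy.
HONEST LABEL: HC_CM is proved only modulo the 2 remaining named inputs (hLiu418 24832, h413 24833) until rung 0 closes; nothing printed is asserted here.

## References
* [Rogawski1990] J. D. Rogawski, *Automorphic Representations of Unitary Groups in Three Variables*, Ann. of Math. Stud. 123 (1990), §4.9 Prop. 4.9.1 (a)(b) p. 55, Lemma 4.9.3
  (the ramified type-(1) κ-orbital integral; the five brackets; counting in an eigenframe).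
* [Kottwitz1986] R. E. Kottwitz, *Base change for unit elements of Hecke algebras*, Compositio Math. 60 (1986), §3 (counting fixed lattices shell by shell).
* [LabesseLanglands1979] J.-P. Labesse, R. P. Langlands, *L-indistinguishability for SL(2)*, Canad. J. Math. 31 (1979), §2 Lemma 2.1, §5 (κ-signed sums over the stable class).
-/

set_option autoImplicit false

noncomputable section

open scoped Valued WithZero Matrix MatrixGroups
open Polynomial Finset
open Literature.NumberTheory.Automorphic Literature.NumberTheory.Automorphic.HermitianLattice Literature.NumberTheory.Automorphic.UnitaryLatticeTree

namespace Literature.NumberTheory.Rogawski1990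

set_option maxHeartbeats 3200000 in  -- measured: fails at 500 000, passes at 1 000 000 (whole-file wall ≈ 42 s); 3× headroom for the buildfix lane
/-- **THE JUNCTION HEAD IN THE EQUILATERAL CONFIGURATION, FROM THE PEN'S ENGINE THEOREM**: hypothesis `hEq` = junction skeleton v4 (e89e5e06) :486 ≡ v7 :764
`strataCount_J₀_equilateral` ∀-closed VERBATIM; binders = the (J★) head's (fold v7.7 :164 ∕ ★ p847532 `hJ`) VERBATIM, plus the configuration `hconf : N₁ = N ∧ N₂ = N`;
conclusion = the head's VERBATIM. [cite: Rogawski1990, §4.9 Prop. 4.9.1 (a) p. 55] [cite: Kottwitz1986, §3] [cite: LabesseLanglands1979, §2 Lemma 2.1] -/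
theorem signedStrataCount_typeOne_ram_equilateral_of_strataCount
    (hEq : ∀ {K : Type} [Field K] [Valued K ℤᵐ⁰] {σ : K →+* K} {ϖ : K} [ValuativeRel K] [(Valued.v : Valuation K ℤᵐ⁰).Compatible]
    (hσ : ∀ x, σ (σ x) = x) (hvσ : ∀ a, Valued.v (σ a) = Valued.v a) (hσϖ : σ ϖ = -ϖ)
    (hϖ : Valued.v ϖ = WithZero.exp (-1 : ℤ)) (hres : ∀ x : K, Valued.v x ≤ 1 → Valued.v (σ x - x) < 1) (h2 : Valued.v (2 : K) = 1)
    (hnorm : ∀ u : K, σ u = u → Valued.v (u - 1) < 1 → ∃ z : K, z * σ z = u ∧ Valued.v (z - 1) ≤ Valued.v (u - 1)) [Fintype 𝓀[K]] [DecidableEq 𝓀[K]]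
    {γ : unitaryGroupOfForm σ ((StdForm.antidiagonal 3).over K)} (hγ0 : γ ∈ unitaryInt σ ((StdForm.antidiagonal 3).over K))
    (d : Fin 3 → K) (hd : ∀ i, Valued.v (d i) = 1) (hdσ : ∀ i, σ (d i) = d i)
    (A : GL (Fin 3) K) (hA : IsIntMatrix (A : Matrix (Fin 3) (Fin 3) K)) (hA' : IsIntMatrix ((A⁻¹ : GL (Fin 3) K) : Matrix (Fin 3) (Fin 3) K))
    (hdA : Matrix.diagonal d = (-(Matrix.diagonal d).det) • formCongr σ A ((StdForm.antidiagonal 3).over K))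
    (s : Fin 3 → K) (hs1 : s 1 = 1) (hsv : ∀ i, Valued.v (s i) = 1) (hsσ : ∀ i, s i * σ (s i) = 1)
    (hγA : ((γ : GL (Fin 3) K) : Matrix (Fin 3) (Fin 3) K) = (A : Matrix (Fin 3) (Fin 3) K) * Matrix.diagonal s * ((A⁻¹ : GL (Fin 3) K) : Matrix (Fin 3) (Fin 3) K))
    {N : ℕ} (hN3 : 3 ≤ N) (hs0 : Valued.v (s 0 - 1) = Valued.v ϖ ^ N) (hs2 : Valued.v (s 2 - 1) = Valued.v ϖ ^ N) (hs02 : Valued.v (s 0 - s 2) = Valued.v ϖ ^ N)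
    (k : ℕ) (hNk : N = 2 * k + 3)
    (c₁ ε : K) (hc₁ : Valued.v c₁ = 1) (hεv : Valued.v ε = 1) (hε : ∀ z : K, Valued.v z ≤ 1 → Valued.v (z ^ 2 - ε) = 1)
    (q : ℕ) (hq : q = Fintype.card 𝓀[K])
    (νE νP νM : ℕ)
    (hνE : ({c : {M : Submodule 𝒪[K] (Fin 3 → K) // IsVertex σ ϖ ((StdForm.antidiagonal 3).over K) M} | (latticeGraph σ ϖ ((StdForm.antidiagonal 3).over K)).Adj ⟨stdLattice K 3, 0, isSelfDualLattice_stdLattice_three_of_v hϖ⟩ c ∧ ∃ κ : unitaryGroupOfForm σ ((StdForm.antidiagonal 3).over K), κ ∈ unitaryInt σ ((StdForm.antidiagonal 3).over K) ∧ c = latticeGraphIso σ ϖ ((StdForm.antidiagonal 3).over K) κ ⟨latt (Matrix.diagonal ![(1 : K), 1, ϖ]), 2, isVertexLattice_two_N₁_of_neg hσϖ hϖ⟩ ∧ (Valued.v ((ϖ ^ N)⁻¹ * pairing σ ((StdForm.antidiagonal 3).over K) (((κ : GL (Fin 3) K) : Matrix (Fin 3) (Fin 3) K) *ᵥ Pi.single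 0 1) ((((γ : GL (Fin 3) K) : Matrix (Fin 3) (Fin 3) K) - 1) *ᵥ (((κ : GL (Fin 3) K) : Matrix (Fin 3) (Fin 3) K) *ᵥ Pi.single 0 1))) < 1)}).ncard = νE)
    (hνP : ({c : {M : Submodule 𝒪[K] (Fin 3 → K) // IsVertex σ ϖ ((StdForm.antidiagonal 3).over K) M} | (latticeGraph σ ϖ ((StdForm.antidiagonal 3).over K)).Adj ⟨stdLattice K 3, 0, isSelfDualLattice_stdLattice_three_of_v hϖ⟩ c ∧ ∃ κ : unitaryGroupOfForm σ ((StdForm.antidiagonal 3).over K), κ ∈ unitaryInt σ ((StdForm.antidiagonal 3).over K) ∧ c = latticeGraphIso σ ϖ ((StdForm.antidiagonal 3).over K) κ ⟨latt (Matrix.diagonal ![(1 : K), 1, ϖ]), 2, isVertexLattice_two_N₁_of_neg hσϖ hϖ⟩ ∧ (∃ a : K, Valued.v a = 1 ∧ Valued.v (((ϖ ^ N)⁻¹ * pairing σ ((StdForm.antidiagonal 3).over K) (((κ : GL (Fin 3) K) : Matrix (Fin 3) (Fin 3) K) *ᵥ Pi.single 0 1) ((((γ : GL (Fin 3) K) :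 Matrix (Fin 3) (Fin 3) K) - 1) *ᵥ (((κ : GL (Fin 3) K) : Matrix (Fin 3) (Fin 3) K) *ᵥ Pi.single 0 1))) - (-c₁) * a ^ 2) < 1)}).ncard = νP)
    (hνM : ({c : {M : Submodule 𝒪[K] (Fin 3 → K) // IsVertex σ ϖ ((StdForm.antidiagonal 3).over K) M} | (latticeGraph σ ϖ ((StdForm.antidiagonal 3).over K)).Adj ⟨stdLattice K 3, 0, isSelfDualLattice_stdLattice_three_of_v hϖ⟩ c ∧ ∃ κ : unitaryGroupOfForm σ ((StdForm.antidiagonal 3).over K), κ ∈ unitaryInt σ ((StdForm.antidiagonal 3).over K) ∧ c = latticeGraphIso σ ϖ ((StdForm.antidiagonal 3).over K) κ ⟨latt (Matrix.diagonal ![(1 : K), 1, ϖ]), 2, isVertexLattice_two_N₁_of_neg hσϖ hϖ⟩ ∧ (∃ a : K, Valued.v a = 1 ∧ Valued.v (((ϖ ^ N)⁻¹ * pairing σ ((StdForm.antidiagonal 3).over K) (((κ : GL (Fin 3) K) : Matrix (Fin 3) (Fin 3) K) *ᵥ Pi.single 0 1) ((((γ : GL (Fin 3) K) : Matrix (Fin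 3) (Fin 3) K) - 1) *ᵥ (((κ : GL (Fin 3) K) : Matrix (Fin 3) (Fin 3) K) *ᵥ Pi.single 0 1))) - (-(c₁ * ε)) * a ^ 2) < 1)}).ncard = νM) (j : Fin 5),
      ({M : Submodule 𝒪[K] (Fin 3 → K) | IsSelfDualLattice σ ϖ ((StdForm.antidiagonal 3).over K) M ∧ mapGL (γ : GL (Fin 3) K) M = M ∧
        (![¬ M.map ((Matrix.toLin' (((γ : GL (Fin 3) K) : Matrix (Fin 3) (Fin 3) K) - 1)).restrictScalars 𝒪[K]) ≤ scaleLattice ϖ M,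
                  M.map ((Matrix.toLin' (((γ : GL (Fin 3) K) : Matrix (Fin 3) (Fin 3) K) - 1)).restrictScalars 𝒪[K]) ≤ scaleLattice ϖ M ∧
                    ¬ M.map ((Matrix.toLin' (((γ : GL (Fin 3) K) : Matrix (Fin 3) (Fin 3) K) - 1)).restrictScalars 𝒪[K]) ≤ scaleLattice (ϖ ^ 2) M ∧
                    ¬ M.map ((Matrix.toLin' ((((γ : GL (Fin 3) K) : Matrix (Fin 3) (Fin 3) K) - 1) ^ 2)).restrictScalars 𝒪[K]) ≤ scaleLattice (ϖ ^ 3) M,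
                  M.map ((Matrix.toLin' (((γ : GL (Fin 3) K) : Matrix (Fin 3) (Fin 3) K) - 1)).restrictScalars 𝒪[K]) ≤ scaleLattice ϖ M ∧
                    ¬ M.map ((Matrix.toLin' (((γ : GL (Fin 3) K) : Matrix (Fin 3) (Fin 3) K) - 1)).restrictScalars 𝒪[K]) ≤ scaleLattice (ϖ ^ 2) M ∧
                    M.map ((Matrix.toLin' ((((γ : GL (Fin 3) K) : Matrix (Fin 3) (Fin 3) K) - 1) ^ 2)).restrictScalars 𝒪[K]) ≤ scaleLattice (ϖ ^ 3) M ∧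
                    ∃ y ∈ M, ∃ a : K, Valued.v a = 1 ∧
                      Valued.v (ϖ⁻¹ * pairing σ (((StdForm.antidiagonal 3).over K)) y
                        ((((γ : GL (Fin 3) K) : Matrix (Fin 3) (Fin 3) K) - 1) *ᵥ y) - c₁ * a ^ 2) < 1,
                  M.map ((Matrix.toLin' (((γ : GL (Fin 3) K) : Matrix (Fin 3) (Fin 3) K) - 1)).restrictScalars 𝒪[K]) ≤ scaleLattice ϖ M ∧
                    ¬ M.map ((Matrix.toLin' (((γ : GL (Fin 3) K) : Matrix (Fin 3) (Fin 3) K) - 1)).restrictScalars 𝒪[K]) ≤ scaleLattice (ϖ ^ 2) M ∧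
                    M.map ((Matrix.toLin' ((((γ : GL (Fin 3) K) : Matrix (Fin 3) (Fin 3) K) - 1) ^ 2)).restrictScalars 𝒪[K]) ≤ scaleLattice (ϖ ^ 3) M ∧
                    ∃ y ∈ M, ∃ a : K, Valued.v a = 1 ∧
                      Valued.v (ϖ⁻¹ * pairing σ (((StdForm.antidiagonal 3).over K)) y
                        ((((γ : GL (Fin 3) K) : Matrix (Fin 3) (Fin 3) K) - 1) *ᵥ y) - c₁ * ε * a ^ 2) < 1,
                  M.map ((Matrix.toLin' (((γ : GL (Fin 3) K) : Matrix (Fin 3) (Fin 3) K) - 1)).restrictScalars 𝒪[K]) ≤ scaleLattice (ϖ ^ 2) M] : Fin 5 → Prop) j}.ncard) =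
      (if IsSquare (-1 : 𝓀[K]) then
          ((![0, 0, 0, 0, 1] : Fin 5 → ℕ) + (q * νE) • (![q ^ (3 * k + 3), q ^ (3 * k + 2), q.choose 2 * q ^ (2 * k) * ∑ i ∈ Finset.range k, q ^ i, q.choose 2 * q ^ (2 * k) * ∑ i ∈ Finset.range k, q ^ i,
          ∑ i ∈ Finset.range (k + 1), q ^ (2 * i) + ∑ i ∈ Finset.range k, q ^ (2 * k + 1 + i)] : Fin 5 → ℕ) + (q * νP) • (![0, 0, q ^ (2 * k), 0, ∑ i ∈ Finset.range k, q ^ (2 * i)] : Fin 5 → ℕ) + (q * νM) • (![0, 0, 0, q ^ (2 * k), ∑ i ∈ Finset.range k, q ^ (2 * i)] : Fin 5 → ℕ)) j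
        else
          ((![0, 0, 0, 0, 1] : Fin 5 → ℕ) + (q * νE) • (![q ^ (3 * k + 3), q ^ (3 * k + 2), q.choose 2 * q ^ (2 * k) * ∑ i ∈ Finset.range k, q ^ i, q.choose 2 * q ^ (2 * k) * ∑ i ∈ Finset.range k, q ^ i,
          ∑ i ∈ Finset.range (k + 1), q ^ (2 * i) + ∑ i ∈ Finset.range k, q ^ (2 * k + 1 + i)] : Fin 5 → ℕ) + (q * νP) • (![0, 0, if Even k then q ^ (2 * k) else 0, if Even k then 0 else q ^ (2 * k), ∑ i ∈ Finset.range k, q ^ (2 * i)] : Fin 5 → ℕ) + (q * νM) • (![0, 0, if Even k then 0 else q ^ (2 * k), if Even k then q ^ (2 * k) else 0, ∑ i ∈ Finset.range k, q ^ (2 * i)] : Fin 5 → ℕ)) j))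
    {K : Type} [Field K] [Valued K ℤᵐ⁰]
      {σ : K →+* K} {ϖ : K} (hσ : ∀ x, σ (σ x) = x) (hvσ : ∀ a, Valued.v (σ a) = Valued.v a) (hϖ : Valued.v ϖ = WithZero.exp (-1 : ℤ)) (hσϖ : σ ϖ = -ϖ)
      (hres : ∀ x : K, Valued.v x ≤ 1 → Valued.v (σ x - x) < 1) (h2 : Valued.v (2 : K) = 1)
      (hnorm : ∀ u : K, σ u = u → Valued.v (u - 1) < 1 → ∃ z : K, z * σ z = u ∧ Valued.v (z - 1) ≤ Valued.v (u - 1)) [Fintype (Valued.ResidueField K)] [DecidableEq (Valued.ResidueField K)]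
      -- the torus datum: σ-fixed INTEGERS `u₀ u₁ u₂` (units), `ε` (a unit, residually a non-square), `c₀` (a unit, the rank-one class constant)
      (u₀ u₁ u₂ ε c₀ : (Valued.integer K)) (hu₀ : Valued.v (u₀ : K) = 1) (hu₁ : Valued.v (u₁ : K) = 1) (hu₂ : Valued.v (u₂ : K) = 1) (hεv : Valued.v (ε : K) = 1) (hc₀ : Valued.v (c₀ : K) = 1)
      (hσu₀ : σ u₀ = u₀) (hσu₁ : σ u₁ = u₁) (hσu₂ : σ u₂ = u₂) (hσε : σ ε = ε) (_hσc₀ : σ c₀ = c₀)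
      (hε : ¬ IsSquare (IsLocalRing.residue (Valued.integer K) ε))
      -- the element: norm-one diagonal entries, `v`-deep (`≡ 1 (ϖ²)`), depths `N₁ = depth(α − u)`, `N₂ = depth(u − γ)` (`N₁ + N₂ = 2m`), `N = depth(α − γ) = 2n+1`, `n ≥ 1`,
      -- with the LEADING COEFFICIENTS `A = (α − u)∕ϖ^{N₁}`, `C = (γ − u)∕ϖ^{N₂}` (integers, units by `hN₁`, `hN₂`) that enter the sign
      (α u γ : K) (hα : α * σ α = 1) (hu : u * σ u = 1) (hγ : γ * σ γ = 1)
      (hα2 : Valued.v (α - 1) ≤ Valued.v ϖ ^ 2) (hu2 : Valued.v (u - 1) ≤ Valued.v ϖ ^ 2) (hγ2 : Valued.v (γ - 1) ≤ Valued.v ϖ ^ 2)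
      (T : GL (Fin 3) K) (hT : (T : Matrix (Fin 3) (Fin 3) K) = Matrix.diagonal ![α, u, γ])
      (N₁ N₂ N m n : ℕ) (hN₁ : Valued.v (α - u) = Valued.v ϖ ^ N₁) (hN₂ : Valued.v (u - γ) = Valued.v ϖ ^ N₂) (hN : Valued.v (α - γ) = Valued.v ϖ ^ N)
      (hm : N₁ + N₂ = 2 * m) (hn : N = 2 * n + 1) (h1n : 1 ≤ n)
      (A C : (Valued.integer K)) (hA : α - u = (A : K) * ϖ ^ N₁) (hC : γ - u = (C : K) * ϖ ^ N₂)
    (hconf : N₁ = N ∧ N₂ = N) :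
    ∀ j : Fin 5,
        ∑ b : Fin 2 × Fin 2, (-1 : ℚ) ^ (b.2 : ℕ) *
          (({M : Submodule (Valued.integer K) (Fin 3 → K) |
              IsSelfDualLattice σ ϖ (Matrix.diagonal ![((ε : K)) ^ (b.1 : ℕ) * (u₀ : K), (ε : K) ^ (b.2 : ℕ) * (u₁ : K), (ε : K) ^ ((b.1 : ℕ) + (b.2 : ℕ)) * (u₂ : K)]) M ∧ mapGL T M = M ∧
                (![-- bd : `¬ (T − 1)M ⊆ ϖM`
                    ¬ M.map ((Matrix.toLin' ((T : Matrix (Fin 3) (Fin 3) K) - 1)).restrictScalars (Valued.integer K)) ≤ scaleLattice ϖ M,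
                  -- reg : depth 1, rank 2
                    M.map ((Matrix.toLin' ((T : Matrix (Fin 3) (Fin 3) K) - 1)).restrictScalars (Valued.integer K)) ≤ scaleLattice ϖ M ∧
                      ¬ M.map ((Matrix.toLin' ((T : Matrix (Fin 3) (Fin 3) K) - 1)).restrictScalars (Valued.integer K)) ≤ scaleLattice (ϖ ^ 2) M ∧
                      ¬ M.map ((Matrix.toLin' (((T : Matrix (Fin 3) (Fin 3) K) - 1) ^ 2)).restrictScalars (Valued.integer K)) ≤ scaleLattice (ϖ ^ 3) M,
                  -- 1s : depth 1, rank 1, class `c₀`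
                    M.map ((Matrix.toLin' ((T : Matrix (Fin 3) (Fin 3) K) - 1)).restrictScalars (Valued.integer K)) ≤ scaleLattice ϖ M ∧
                      ¬ M.map ((Matrix.toLin' ((T : Matrix (Fin 3) (Fin 3) K) - 1)).restrictScalars (Valued.integer K)) ≤ scaleLattice (ϖ ^ 2) M ∧
                      M.map ((Matrix.toLin' (((T : Matrix (Fin 3) (Fin 3) K) - 1) ^ 2)).restrictScalars (Valued.integer K)) ≤ scaleLattice (ϖ ^ 3) M ∧
                      ∃ y ∈ M, ∃ a : K, Valued.v a = 1 ∧
                        Valued.v (ϖ⁻¹ * pairing σ (Matrix.diagonal ![((ε : K)) ^ (b.1 : ℕ) * (u₀ : K), (ε : K) ^ (b.2 : ℕ) * (u₁ : K), (ε : K) ^ ((b.1 : ℕ) + (b.2 : ℕ)) * (u₂ : K)]) y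
                          (((T : Matrix (Fin 3) (Fin 3) K) - 1) *ᵥ y) - (c₀ : K) * a ^ 2) < 1,
                  -- 1n : depth 1, rank 1, class `c₀·ε`
                    M.map ((Matrix.toLin' ((T : Matrix (Fin 3) (Fin 3) K) - 1)).restrictScalars (Valued.integer K)) ≤ scaleLattice ϖ M ∧
                      ¬ M.map ((Matrix.toLin' ((T : Matrix (Fin 3) (Fin 3) K) - 1)).restrictScalars (Valued.integer K)) ≤ scaleLattice (ϖ ^ 2) M ∧
                      M.map ((Matrix.toLin' (((T : Matrix (Fin 3) (Fin 3) K) - 1) ^ 2)).restrictScalars (Valued.integer K)) ≤ scaleLattice (ϖ ^ 3) M ∧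
                      ∃ y ∈ M, ∃ a : K, Valued.v a = 1 ∧
                        Valued.v (ϖ⁻¹ * pairing σ (Matrix.diagonal ![((ε : K)) ^ (b.1 : ℕ) * (u₀ : K), (ε : K) ^ (b.2 : ℕ) * (u₁ : K), (ε : K) ^ ((b.1 : ℕ) + (b.2 : ℕ)) * (u₂ : K)]) y
                          (((T : Matrix (Fin 3) (Fin 3) K) - 1) *ᵥ y) - (c₀ : K) * (ε : K) * a ^ 2) < 1,
                  -- 0 : depth ≥ 2
                    M.map ((Matrix.toLin' ((T : Matrix (Fin 3) (Fin 3) K) - 1)).restrictScalars (Valued.integer K)) ≤ scaleLattice (ϖ ^ 2) M] : Fin 5 → Prop) j}.ncard : ℕ) : ℚ) =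
          ((quadraticChar (Valued.ResidueField K) (IsLocalRing.residue (Valued.integer K) ((-1) ^ m * (u₀ * u₂ * A * C))) : ℤ) : ℚ) * (Fintype.card (Valued.ResidueField K) : ℚ) ^ m *
            (![4 * (Fintype.card (Valued.ResidueField K) : ℚ) ^ n, 4 * (Fintype.card (Valued.ResidueField K) : ℚ) ^ (n - 1), (2 * ((Fintype.card (Valued.ResidueField K) : ℚ) ^ n - Fintype.card (Valued.ResidueField K) - 1)) / (Fintype.card (Valued.ResidueField K) : ℚ) ^ 2,
                (2 * ((Fintype.card (Valued.ResidueField K) : ℚ) ^ n - Fintype.card (Valued.ResidueField K) - 1)) / (Fintype.card (Valued.ResidueField K) : ℚ) ^ 2,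
                (4 * ((Fintype.card (Valued.ResidueField K) : ℚ) ^ n - 1)) / (((Fintype.card (Valued.ResidueField K) : ℚ) - 1) * (Fintype.card (Valued.ResidueField K) : ℚ) ^ 2)] : Fin 5 → ℚ) j := by
  classical
  intro j
  obtain ⟨hN₁N, hN₂N⟩ := hconf
  rw [hN₁N] at hN₁ hA hm
  rw [hN₂N] at hN₂ hC hm
  have hmN : m = N := by omega
  obtain ⟨k, hnk⟩ : ∃ k, n = k + 1 := ⟨n - 1, by omega⟩
  have hNk : N = 2 * k + 3 := by omega
  have hN3 : 3 ≤ N := by omega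
  -- instances for the engine statement
  letI : ValuativeRel K := ValuativeRel.ofValuation (Valued.v : Valuation K ℤᵐ⁰)
  haveI : (Valued.v : Valuation K ℤᵐ⁰).Compatible := Valuation.Compatible.ofValuation _
  -- basic facts
  have hϖ0 : ϖ ≠ 0 := fun h0 => by rw [h0, map_zero] at hϖ; exact WithZero.coe_ne_zero hϖ.symm
  have hvϖ0 : Valued.v ϖ ≠ 0 := (Valuation.ne_zero_iff _).2 hϖ0
  have hvϖN : Valued.v ϖ ^ N ≠ 0 := pow_ne_zero _ hvϖ0
  have hk2 : ringChar 𝓀[K] ≠ 2 := ringChar_residueField_ne_two h2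
  have hres0 : ∀ x : 𝒪[K], Valued.v (x : K) = 1 → IsLocalRing.residue 𝒪[K] x ≠ 0 := fun x hx h => by
    rw [residue_eq_zero_iff_v_lt_one, hx] at h
    exact lt_irrefl _ h
  have hu₀' := hres0 u₀ hu₀
  have hu₁' := hres0 u₁ hu₁
  have hu₂' := hres0 u₂ hu₂
  have hc₀' := hres0 c₀ hc₀
  have hε' := hres0 ε hεv
  have hεχ : quadraticChar 𝓀[K] (IsLocalRing.residue 𝒪[K] ε) = -1 := (quadraticChar_neg_one_iff_not_isSquare).2 hε
  have huv : Valued.v u = 1 := v_eq_one_of_mul_map_eq_one hvσ hu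
  have hαv : Valued.v α = 1 := v_eq_one_of_mul_map_eq_one hvσ hα
  have hγv : Valued.v γ = 1 := v_eq_one_of_mul_map_eq_one hvσ hγ
  have hu0 : u ≠ 0 := fun h => by rw [h, map_zero] at huv; exact zero_ne_one huv
  have huinv : Valued.v u⁻¹ = 1 := by rw [map_inv₀, huv, inv_one]
  let uinv : 𝒪[K] := ⟨u⁻¹, (Valuation.mem_integer_iff _ _).2 huinv.le⟩
  have huinv' : IsLocalRing.residue 𝒪[K] uinv ≠ 0 := hres0 uinv huinv
  -- the leading coefficients
  have hAv : Valued.v (A : K) = 1 := by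
    have h := hN₁
    rw [hA, map_mul, map_pow] at h
    exact (mul_eq_right₀ hvϖN).1 h
  have hCv : Valued.v (C : K) = 1 := by
    have h := hN₂
    rw [← Valuation.map_neg, neg_sub, hC, map_mul, map_pow] at h
    exact (mul_eq_right₀ hvϖN).1 h
  have hACv : Valued.v ((A : K) - C) = 1 := by
    have h : α - γ = ((A : K) - C) * ϖ ^ N := by
      have e : α - γ = (α - u) - (γ - u) := by ring
      rw [e, hA, hC]; ring
    have h' := hN
    rw [h, map_mul, map_pow] at h'
    exact (mul_eq_right₀ hvϖN).1 h'
  let t : Fin 3 → 𝒪[K] := ![A * uinv, 0, C * uinv]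
  have ht0 : ((t 0 : 𝒪[K]) : K) = (A : K) * u⁻¹ := rfl
  have ht2 : ((t 2 : 𝒪[K]) : K) = (C : K) * u⁻¹ := rfl
  have htAv : Valued.v ((t 0 : 𝒪[K]) : K) = 1 := by rw [ht0, map_mul, hAv, huinv, one_mul]
  have htCv : Valued.v ((t 2 : 𝒪[K]) : K) = 1 := by rw [ht2, map_mul, hCv, huinv, one_mul]
  have htA' := hres0 _ htAv
  have htC' := hres0 _ htCv
  have htAC : IsLocalRing.residue 𝒪[K] (t 0) ≠ IsLocalRing.residue 𝒪[K] (t 2) := by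
    intro h
    rw [← sub_eq_zero, ← map_sub, residue_eq_zero_iff_v_lt_one] at h
    have e : (((t 0 - t 2 : 𝒪[K])) : K) = ((A : K) - C) * u⁻¹ := by
      push_cast
      rw [ht0, ht2]
      ring
    rw [e, map_mul, hACv, huinv, one_mul] at h
    exact lt_irrefl _ h
  have ht : ∀ i, (![α / u, 1, γ / u] : Fin 3 → K) i - 1 = ((t i : 𝒪[K]) : K) * ϖ ^ N := by
    intro i
    fin_cases i
    · show α / u - 1 = ((t 0 : 𝒪[K]) : K) * ϖ ^ N
      rw [ht0, div_sub_one hu0, hA]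
      field_simp
    · show (1 : K) - 1 = (((0 : 𝒪[K])) : K) * ϖ ^ N
      simp
    · show γ / u - 1 = ((t 2 : 𝒪[K]) : K) * ϖ ^ N
      rw [ht2, div_sub_one hu0, hC]
      field_simp
  -- residual non-square in valuation form
  have hεns : ∀ z : K, Valued.v z ≤ 1 → Valued.v (z ^ 2 - ε) = 1 := by
    intro z hz
    have hzO : z ∈ 𝒪[K] := (Valuation.mem_integer_iff _ _).2 hz
    have hint : Valued.v (z ^ 2 - (ε : K)) ≤ 1 := by
      have : ((⟨z, hzO⟩ ^ 2 - ε : 𝒪[K]) : K) = z ^ 2 - (ε : K) := by push_cast; rfl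
      rw [← this]; exact ((⟨z, hzO⟩ ^ 2 - ε : 𝒪[K])).2
    rcases hint.lt_or_eq with hlt | heq
    · exfalso
      apply hε
      have h0 : IsLocalRing.residue 𝒪[K] (⟨z, hzO⟩ ^ 2 - ε) = 0 := by
        rw [residue_eq_zero_iff_v_lt_one]; push_cast; exact hlt
      rw [map_sub, map_pow, sub_eq_zero] at h0
      exact ⟨IsLocalRing.residue 𝒪[K] ⟨z, hzO⟩, by rw [← h0, pow_two]⟩
    · exact heq
  -- THE PER-LITERAL STEP: transport ∘ engine ∘ FILE 1
  have key : ∀ b : Fin 2 × Fin 2, ∃ νE νP νM : ℕ,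
      (({M : Submodule (Valued.integer K) (Fin 3 → K) |
              IsSelfDualLattice σ ϖ (Matrix.diagonal ![((ε : K)) ^ (b.1 : ℕ) * (u₀ : K), (ε : K) ^ (b.2 : ℕ) * (u₁ : K), (ε : K) ^ ((b.1 : ℕ) + (b.2 : ℕ)) * (u₂ : K)]) M ∧ mapGL T M = M ∧
                (![-- bd : `¬ (T − 1)M ⊆ ϖM`
                    ¬ M.map ((Matrix.toLin' ((T : Matrix (Fin 3) (Fin 3) K) - 1)).restrictScalars (Valued.integer K)) ≤ scaleLattice ϖ M,
                  -- reg : depth 1, rank 2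
                    M.map ((Matrix.toLin' ((T : Matrix (Fin 3) (Fin 3) K) - 1)).restrictScalars (Valued.integer K)) ≤ scaleLattice ϖ M ∧
                      ¬ M.map ((Matrix.toLin' ((T : Matrix (Fin 3) (Fin 3) K) - 1)).restrictScalars (Valued.integer K)) ≤ scaleLattice (ϖ ^ 2) M ∧
                      ¬ M.map ((Matrix.toLin' (((T : Matrix (Fin 3) (Fin 3) K) - 1) ^ 2)).restrictScalars (Valued.integer K)) ≤ scaleLattice (ϖ ^ 3) M,
                  -- 1s : depth 1, rank 1, class `c₀`
                    M.map ((Matrix.toLin' ((T : Matrix (Fin 3) (Fin 3) K) - 1)).restrictScalars (Valued.integer K)) ≤ scaleLattice ϖ M ∧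
                      ¬ M.map ((Matrix.toLin' ((T : Matrix (Fin 3) (Fin 3) K) - 1)).restrictScalars (Valued.integer K)) ≤ scaleLattice (ϖ ^ 2) M ∧
                      M.map ((Matrix.toLin' (((T : Matrix (Fin 3) (Fin 3) K) - 1) ^ 2)).restrictScalars (Valued.integer K)) ≤ scaleLattice (ϖ ^ 3) M ∧
                      ∃ y ∈ M, ∃ a : K, Valued.v a = 1 ∧
                        Valued.v (ϖ⁻¹ * pairing σ (Matrix.diagonal ![((ε : K)) ^ (b.1 : ℕ) * (u₀ : K), (ε : K) ^ (b.2 : ℕ) * (u₁ : K), (ε : K) ^ ((b.1 : ℕ) + (b.2 : ℕ)) * (u₂ : K)]) y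
                          (((T : Matrix (Fin 3) (Fin 3) K) - 1) *ᵥ y) - (c₀ : K) * a ^ 2) < 1,
                  -- 1n : depth 1, rank 1, class `c₀·ε`
                    M.map ((Matrix.toLin' ((T : Matrix (Fin 3) (Fin 3) K) - 1)).restrictScalars (Valued.integer K)) ≤ scaleLattice ϖ M ∧
                      ¬ M.map ((Matrix.toLin' ((T : Matrix (Fin 3) (Fin 3) K) - 1)).restrictScalars (Valued.integer K)) ≤ scaleLattice (ϖ ^ 2) M ∧
                      M.map ((Matrix.toLin' (((T : Matrix (Fin 3) (Fin 3) K) - 1) ^ 2)).restrictScalars (Valued.integer K)) ≤ scaleLattice (ϖ ^ 3) M ∧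
                      ∃ y ∈ M, ∃ a : K, Valued.v a = 1 ∧
                        Valued.v (ϖ⁻¹ * pairing σ (Matrix.diagonal ![((ε : K)) ^ (b.1 : ℕ) * (u₀ : K), (ε : K) ^ (b.2 : ℕ) * (u₁ : K), (ε : K) ^ ((b.1 : ℕ) + (b.2 : ℕ)) * (u₂ : K)]) y
                          (((T : Matrix (Fin 3) (Fin 3) K) - 1) *ᵥ y) - (c₀ : K) * (ε : K) * a ^ 2) < 1,
                  -- 0 : depth ≥ 2
                    M.map ((Matrix.toLin' ((T : Matrix (Fin 3) (Fin 3) K) - 1)).restrictScalars (Valued.integer K)) ≤ scaleLattice (ϖ ^ 2) M] : Fin 5 → Prop) j}).ncard = (if IsSquare (-1 : 𝓀[K]) then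
          ((![0, 0, 0, 0, 1] : Fin 5 → ℕ) + ((Fintype.card 𝓀[K]) * νE) • (![(Fintype.card 𝓀[K]) ^ (3 * k + 3), (Fintype.card 𝓀[K]) ^ (3 * k + 2), (Fintype.card 𝓀[K]).choose 2 * (Fintype.card 𝓀[K]) ^ (2 * k) * ∑ i ∈ Finset.range k, (Fintype.card 𝓀[K]) ^ i, (Fintype.card 𝓀[K]).choose 2 * (Fintype.card 𝓀[K]) ^ (2 * k) * ∑ i ∈ Finset.range k, (Fintype.card 𝓀[K]) ^ i,
          ∑ i ∈ Finset.range (k + 1), (Fintype.card 𝓀[K]) ^ (2 * i) + ∑ i ∈ Finset.range k, (Fintype.card 𝓀[K]) ^ (2 * k + 1 + i)] : Fin 5 → ℕ) + ((Fintype.card 𝓀[K]) * νP) • (![0, 0, (Fintype.card 𝓀[K]) ^ (2 * k), 0, ∑ i ∈ Finset.range k, (Fintype.card 𝓀[K]) ^ (2 * i)] : Fin 5 → ℕ) + ((Fintype.card 𝓀[K]) * νM) • (![0, 0, 0, (Fintype.card 𝓀[K]) ^ (2 * k), ∑ i ∈ Finset.range k, (Fintype.card 𝓀[K]) ^ (2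 * i)] : Fin 5 → ℕ)) j
        else
          ((![0, 0, 0, 0, 1] : Fin 5 → ℕ) + ((Fintype.card 𝓀[K]) * νE) • (![(Fintype.card 𝓀[K]) ^ (3 * k + 3), (Fintype.card 𝓀[K]) ^ (3 * k + 2), (Fintype.card 𝓀[K]).choose 2 * (Fintype.card 𝓀[K]) ^ (2 * k) * ∑ i ∈ Finset.range k, (Fintype.card 𝓀[K]) ^ i, (Fintype.card 𝓀[K]).choose 2 * (Fintype.card 𝓀[K]) ^ (2 * k) * ∑ i ∈ Finset.range k, (Fintype.card 𝓀[K]) ^ i,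
          ∑ i ∈ Finset.range (k + 1), (Fintype.card 𝓀[K]) ^ (2 * i) + ∑ i ∈ Finset.range k, (Fintype.card 𝓀[K]) ^ (2 * k + 1 + i)] : Fin 5 → ℕ) + ((Fintype.card 𝓀[K]) * νP) • (![0, 0, if Even k then (Fintype.card 𝓀[K]) ^ (2 * k) else 0, if Even k then 0 else (Fintype.card 𝓀[K]) ^ (2 * k), ∑ i ∈ Finset.range k, (Fintype.card 𝓀[K]) ^ (2 * i)] : Fin 5 → ℕ) + ((Fintype.card 𝓀[K]) * νM) • (![0, 0, if Even k then 0 else (Fintype.card 𝓀[K]) ^ (2 * k), if Even k then (Fintype.card 𝓀[K]) ^ (2 * k) else 0, ∑ i ∈ Finset.range k, (Fintype.card 𝓀[K]) ^ (2 * i)] : Fin 5 → ℕ)) j)) ∧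
      νE = (univ.filter fun p : 𝓀[K] × 𝓀[K] =>
          IsLocalRing.residue 𝒪[K] ε ^ (b.1 : ℕ) * IsLocalRing.residue 𝒪[K] u₀ + IsLocalRing.residue 𝒪[K] ε ^ (b.2 : ℕ) * IsLocalRing.residue 𝒪[K] u₁ * p.1 ^ 2 + IsLocalRing.residue 𝒪[K] ε ^ ((b.1 : ℕ) + b.2) * IsLocalRing.residue 𝒪[K] u₂ * p.2 ^ 2 = 0 ∧
            IsLocalRing.residue 𝒪[K] ε ^ (b.1 : ℕ) * IsLocalRing.residue 𝒪[K] u₀ * IsLocalRing.residue 𝒪[K] (t 0) + IsLocalRing.residue 𝒪[K] ε ^ ((b.1 : ℕ) + b.2) * IsLocalRing.residue 𝒪[K] u₂ * IsLocalRing.residue 𝒪[K] (t 2) * p.2 ^ 2 = 0).card ∧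
      (Nat.card 𝓀[K] - 1) * νP = (univ.filter fun v : 𝓀[K] × 𝓀[K] × 𝓀[K] =>
          IsLocalRing.residue 𝒪[K] ε ^ (b.1 : ℕ) * IsLocalRing.residue 𝒪[K] u₀ * v.1 ^ 2 + IsLocalRing.residue 𝒪[K] ε ^ (b.2 : ℕ) * IsLocalRing.residue 𝒪[K] u₁ * v.2.1 ^ 2 + IsLocalRing.residue 𝒪[K] ε ^ ((b.1 : ℕ) + b.2) * IsLocalRing.residue 𝒪[K] u₂ * v.2.2 ^ 2 = 0 ∧
            quadraticChar 𝓀[K] ((-(IsLocalRing.residue 𝒪[K] c₀)⁻¹) * (IsLocalRing.residue 𝒪[K] ε ^ (b.1 : ℕ) * IsLocalRing.residue 𝒪[K] u₀ * IsLocalRing.residue 𝒪[K] (t 0) * v.1 ^ 2 + IsLocalRing.residue 𝒪[K] ε ^ ((b.1 : ℕ) + b.2) * IsLocalRing.residue 𝒪[K] u₂ * IsLocalRing.residue 𝒪[K] (t 2) * v.2.2 ^ 2)) = 1).card ∧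
      (Nat.card 𝓀[K] - 1) * νM = (univ.filter fun v : 𝓀[K] × 𝓀[K] × 𝓀[K] =>
          IsLocalRing.residue 𝒪[K] ε ^ (b.1 : ℕ) * IsLocalRing.residue 𝒪[K] u₀ * v.1 ^ 2 + IsLocalRing.residue 𝒪[K] ε ^ (b.2 : ℕ) * IsLocalRing.residue 𝒪[K] u₁ * v.2.1 ^ 2 + IsLocalRing.residue 𝒪[K] ε ^ ((b.1 : ℕ) + b.2) * IsLocalRing.residue 𝒪[K] u₂ * v.2.2 ^ 2 = 0 ∧
            quadraticChar 𝓀[K] ((-(IsLocalRing.residue 𝒪[K] c₀)⁻¹) * (IsLocalRing.residue 𝒪[K] ε ^ (b.1 : ℕ) * IsLocalRing.residue 𝒪[K] u₀ * IsLocalRing.residue 𝒪[K] (t 0) * v.1 ^ 2 + IsLocalRing.residue 𝒪[K] ε ^ ((b.1 : ℕ) + b.2) * IsLocalRing.residue 𝒪[K] u₂ * IsLocalRing.residue 𝒪[K] (t 2) * v.2.2 ^ 2)) = -1).card := by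
    intro b
    obtain ⟨hd, hdσ, Ab, hAb, hAb', hdA⟩ := exists_frame_literalDiag u₀ u₁ u₂ ε b hσ hvσ hres h2 hnorm hu₀ hu₁ hu₂ hεv hσu₀ hσu₁ hσu₂ hσε
    obtain ⟨hs1, hsv, hsσ, γ', hγ'0, hγ'A⟩ := exists_mem_unitaryInt_coe_eq_conj_diagonal_div hvσ hd hAb hAb' hdA hα hu hγ
    obtain ⟨hs0', hs2', hs02'⟩ := v_spectrum_div_sub (α := α) (γ := γ) hvσ hu
    -- the `𝒪`-version of `d_b`
    let d₀ : Fin 3 → 𝒪[K] := ![ε ^ (b.1 : ℕ) * u₀, ε ^ (b.2 : ℕ) * u₁, ε ^ ((b.1 : ℕ) + (b.2 : ℕ)) * u₂]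
    have hd₀0 : d₀ 0 = ε ^ (b.1 : ℕ) * u₀ := rfl
    have hd₀1 : d₀ 1 = ε ^ (b.2 : ℕ) * u₁ := rfl
    have hd₀2 : d₀ 2 = ε ^ ((b.1 : ℕ) + (b.2 : ℕ)) * u₂ := rfl
    have hd₀ : ∀ i, (d₀ i : K) = (![((ε : K)) ^ (b.1 : ℕ) * (u₀ : K), (ε : K) ^ (b.2 : ℕ) * (u₁ : K), (ε : K) ^ ((b.1 : ℕ) + (b.2 : ℕ)) * (u₂ : K)] : Fin 3 → K) i := by
      intro i
      fin_cases i
      · show ((d₀ 0 : 𝒪[K]) : K) = (ε : K) ^ (b.1 : ℕ) * (u₀ : K)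
        rw [hd₀0]; push_cast; rfl
      · show ((d₀ 1 : 𝒪[K]) : K) = (ε : K) ^ (b.2 : ℕ) * (u₁ : K)
        rw [hd₀1]; push_cast; rfl
      · show ((d₀ 2 : 𝒪[K]) : K) = (ε : K) ^ ((b.1 : ℕ) + (b.2 : ℕ)) * (u₂ : K)
        rw [hd₀2]; push_cast; rfl
    have hprod : (((-∏ i, d₀ i : 𝒪[K])) : K) = -(Matrix.diagonal (![((ε : K)) ^ (b.1 : ℕ) * (u₀ : K), (ε : K) ^ (b.2 : ℕ) * (u₁ : K), (ε : K) ^ ((b.1 : ℕ) + (b.2 : ℕ)) * (u₂ : K)] : Fin 3 → K)).det := by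
      rw [Matrix.det_diagonal]
      push_cast
      exact congrArg Neg.neg (Finset.prod_congr rfl fun i _ => hd₀ i)
    -- the `u`-normalised literal `T″ = A⁻¹γ′A` and its conjugate
    have hT'' : ((Ab⁻¹ * (γ' : GL (Fin 3) K) * Ab : GL (Fin 3) K) : Matrix (Fin 3) (Fin 3) K) = Matrix.diagonal ![α / u, 1, γ / u] := by
      rw [Units.val_mul, Units.val_mul, hγ'A]
      simp only [Matrix.mul_assoc, Units.inv_mul, Matrix.mul_one]
      rw [← Matrix.mul_assoc, Units.inv_mul, Matrix.one_mul]
    have hconj : Ab * (Ab⁻¹ * (γ' : GL (Fin 3) K) * Ab) * Ab⁻¹ = (γ' : GL (Fin 3) K) := by group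
    -- the transport constant `c₁ = (−det diag d_b)⁻¹·c₀`
    have hDv : Valued.v (((-∏ i, d₀ i : 𝒪[K])) : K) = 1 := by
      push_cast
      rw [Valuation.map_neg, map_prod]
      exact Finset.prod_eq_one fun i _ => by rw [hd₀ i]; exact hd i
    have hD0 : (((-∏ i, d₀ i : 𝒪[K])) : K) ≠ 0 := fun h => by rw [h, map_zero] at hDv; exact zero_ne_one hDv
    have hD' : IsLocalRing.residue 𝒪[K] (-∏ i, d₀ i) ≠ 0 := hres0 _ hDv
    set c₁ : K := ((((-∏ i, d₀ i : 𝒪[K])) : K))⁻¹ * (c₀ : K) with hc₁def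
    have hc : (c₀ : K) = -(Matrix.diagonal (![((ε : K)) ^ (b.1 : ℕ) * (u₀ : K), (ε : K) ^ (b.2 : ℕ) * (u₁ : K), (ε : K) ^ ((b.1 : ℕ) + (b.2 : ℕ)) * (u₂ : K)] : Fin 3 → K)).det * c₁ := by
      rw [← hprod, hc₁def, mul_inv_cancel_left₀ hD0]
    have hc₁v : Valued.v c₁ = 1 := by rw [hc₁def, map_mul, map_inv₀, hDv, inv_one, one_mul, hc₀]
    -- the class constants of the two classes as elements of `𝒪`, and their residues
    have hcP : Valued.v (-c₁) = 1 := by rw [Valuation.map_neg, hc₁v]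
    have hcM : Valued.v (-(c₁ * (ε : K))) = 1 := by rw [Valuation.map_neg, map_mul, hc₁v, hεv, one_mul]
    let cP : 𝒪[K] := ⟨-c₁, (Valuation.mem_integer_iff _ _).2 hcP.le⟩
    let cM : 𝒪[K] := ⟨-(c₁ * (ε : K)), (Valuation.mem_integer_iff _ _).2 hcM.le⟩
    have hcPD : cP * (-∏ i, d₀ i) = -c₀ := by
      apply Subtype.ext
      push_cast
      show -c₁ * (((-∏ i, d₀ i : 𝒪[K])) : K) = -(c₀ : K)
      rw [hc₁def]; field_simp
    have hcMD : cM * (-∏ i, d₀ i) = -(c₀ * ε) := by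
      apply Subtype.ext
      push_cast
      show -(c₁ * (ε : K)) * (((-∏ i, d₀ i : 𝒪[K])) : K) = -((c₀ : K) * (ε : K))
      rw [hc₁def]; field_simp
    have hconstP : (IsLocalRing.residue 𝒪[K] cP)⁻¹ * (IsLocalRing.residue 𝒪[K] (-∏ i, d₀ i))⁻¹ = -(IsLocalRing.residue 𝒪[K] c₀)⁻¹ := by
      rw [← mul_inv, ← map_mul, hcPD, map_neg, neg_inv]
    have hconstM : (IsLocalRing.residue 𝒪[K] cM)⁻¹ * (IsLocalRing.residue 𝒪[K] (-∏ i, d₀ i))⁻¹ = (IsLocalRing.residue 𝒪[K] ε)⁻¹ * (-(IsLocalRing.residue 𝒪[K] c₀)⁻¹) := by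
      rw [← mul_inv, ← map_mul, hcMD, map_neg, map_mul]
      field_simp
    -- TRANSPORT (★ p847541) and ENGINE (`hEq`)
    have htr := ncard_strata_diagonal_eq_ncard_strata_antidiagonal_of_central hvσ hϖ _ hd hdσ Ab hdA α u γ hαv huv hγv hα2 hu2 hγ2 T
      (Ab⁻¹ * (γ' : GL (Fin 3) K) * Ab) hT hT'' (c₀ : K) c₁ (ε : K) hc₀ hc j
    rw [hconj] at htr
    have heng := hEq hσ hvσ hσϖ hϖ hres h2 hnorm hγ'0 _ hd hdσ Ab hAb hAb' hdA _ hs1 hsv hsσ hγ'A hN3 (hs0'.trans hN₁) (hs2'.trans hN₂) (hs02'.trans hN) k hNk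
      c₁ (ε : K) hc₁v hεv hεns (Fintype.card 𝓀[K]) rfl _ _ _ rfl rfl rfl j
    refine ⟨_, _, _, htr.trans heng, ?_, ?_, ?_⟩
    · -- νE (FILE 1, null half)
      have h1 := ncard_rootNullLines_eq_card_filter hσ hvσ hσϖ hϖ hres h2 (γ := γ') _ d₀ hd₀ hd Ab hAb hAb' hdA _ hs1 hγ'A t ht htCv
      rw [h1]
      simp only [hd₀0, hd₀1, hd₀2, map_mul (IsLocalRing.residue 𝒪[K]), map_pow (IsLocalRing.residue 𝒪[K])]
    · -- νP (FILE 1, class half with constant `−c₁`)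
      have h2P := card_sub_one_mul_ncard_rootClassLines_eq_card_filter hσ hvσ hσϖ hϖ hres h2 (γ := γ') _ d₀ hd₀ hd Ab hAb hAb' hdA _ hs1 hγ'A t ht
        (-c₁) cP rfl hcP
      rw [h2P, hconstP]
      simp only [hd₀0, hd₀1, hd₀2, map_mul (IsLocalRing.residue 𝒪[K]), map_pow (IsLocalRing.residue 𝒪[K])]
    · -- νM (FILE 1, class half with constant `−(c₁ε)`, then the non-square flip)
      have h2M := card_sub_one_mul_ncard_rootClassLines_eq_card_filter hσ hvσ hσϖ hϖ hres h2 (γ := γ') _ d₀ hd₀ hd Ab hAb hAb' hdA _ hs1 hγ'A t ht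
        (-(c₁ * (ε : K))) cM rfl hcM
      rw [h2M, hconstM]
      simp only [hd₀0, hd₀1, hd₀2, map_mul (IsLocalRing.residue 𝒪[K]), map_pow (IsLocalRing.residue 𝒪[K]), mul_assoc ((IsLocalRing.residue 𝒪[K] ε)⁻¹)]
      have hεinv : quadraticChar 𝓀[K] ((IsLocalRing.residue 𝒪[K] ε)⁻¹) = -1 := by
        have e : (IsLocalRing.residue 𝒪[K] ε)⁻¹ = IsLocalRing.residue 𝒪[K] ε * ((IsLocalRing.residue 𝒪[K] ε)⁻¹) ^ 2 := by field_simp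
        rw [e, map_mul, quadraticChar_sq_one' (inv_ne_zero hε'), mul_one, hεχ]
      exact card_filter_quadraticChar_mul_eq_one_eq_of_eq_neg_one hεinv _ _
  choose νE νP νM hcnt hE hP hM using key
  -- THE κ-SIGNED SUMS OF THE ROOT LINE COUNTS (★ RootTwists ∕ ★ RootClassSplit)
  have hq1 : 1 ≤ Fintype.card 𝓀[K] := Fintype.card_pos
  have hq2 : 2 ≤ Fintype.card 𝓀[K] := Fintype.one_lt_card
  have hcard : Nat.card 𝓀[K] = Fintype.card 𝓀[K] := Nat.card_eq_fintype_card
  have hqne : ((Fintype.card 𝓀[K] : ℤ) - 1) ≠ 0 := by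
    have : (1 : ℤ) < Fintype.card 𝓀[K] := by exact_mod_cast hq2
    linarith
  set χ₀ : ℤ := quadraticChar 𝓀[K] (-(IsLocalRing.residue 𝒪[K] u₀ * IsLocalRing.residue 𝒪[K] u₂ * IsLocalRing.residue 𝒪[K] (t 0) * IsLocalRing.residue 𝒪[K] (t 2))) with hχ₀
  have hSE : ∑ b : Fin 2 × Fin 2, (-1 : ℤ) ^ (b.2 : ℕ) * (νE b : ℤ) = 4 * χ₀ := by
    rw [hχ₀, ← signedSum_card_rootNull_twists hk2 hεχ hu₁' hu₂' htC']
    exact Finset.sum_congr rfl fun b _ => by rw [hE b]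
  have hcne : -(IsLocalRing.residue 𝒪[K] c₀)⁻¹ ≠ 0 := neg_ne_zero.2 (inv_ne_zero hc₀')
  have hPz : ∀ b, ((Fintype.card 𝓀[K] : ℤ) - 1) * (νP b : ℤ) = (((Nat.card 𝓀[K] - 1) * νP b : ℕ) : ℤ) := fun b => by
    rw [hcard]; push_cast [Nat.cast_sub hq1]; ring
  have hMz : ∀ b, ((Fintype.card 𝓀[K] : ℤ) - 1) * (νM b : ℤ) = (((Nat.card 𝓀[K] - 1) * νM b : ℕ) : ℤ) := fun b => by
    rw [hcard]; push_cast [Nat.cast_sub hq1]; ring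
  have hSP : ∑ b : Fin 2 × Fin 2, (-1 : ℤ) ^ (b.2 : ℕ) * (νP b : ℤ) = -2 * χ₀ := by
    have h := signedSum_card_rootClass_twists hk2 hεχ hu₀' hu₁' hu₂' htA' htC' htAC hcne (σ := 1) (Or.inl rfl)
    have h2 : ((Fintype.card 𝓀[K] : ℤ) - 1) * ∑ b : Fin 2 × Fin 2, (-1 : ℤ) ^ (b.2 : ℕ) * (νP b : ℤ) = ((Fintype.card 𝓀[K] : ℤ) - 1) * (-2 * χ₀) := by
      rw [Finset.mul_sum, show ((Fintype.card 𝓀[K] : ℤ) - 1) * (-2 * χ₀) = -2 * ((Fintype.card 𝓀[K] : ℤ) - 1) * χ₀ by ring, hχ₀, ← h]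
      exact Finset.sum_congr rfl fun b _ => by rw [mul_left_comm, hPz b, hP b]
    exact mul_left_cancel₀ hqne h2
  have hSM : ∑ b : Fin 2 × Fin 2, (-1 : ℤ) ^ (b.2 : ℕ) * (νM b : ℤ) = -2 * χ₀ := by
    have h := signedSum_card_rootClass_twists hk2 hεχ hu₀' hu₁' hu₂' htA' htC' htAC hcne (σ := -1) (Or.inr rfl)
    have h2 : ((Fintype.card 𝓀[K] : ℤ) - 1) * ∑ b : Fin 2 × Fin 2, (-1 : ℤ) ^ (b.2 : ℕ) * (νM b : ℤ) = ((Fintype.card 𝓀[K] : ℤ) - 1) * (-2 * χ₀) := by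
      rw [Finset.mul_sum, show ((Fintype.card 𝓀[K] : ℤ) - 1) * (-2 * χ₀) = -2 * ((Fintype.card 𝓀[K] : ℤ) - 1) * χ₀ by ring, hχ₀, ← h]
      exact Finset.sum_congr rfl fun b _ => by rw [mul_left_comm, hMz b, hM b]
    exact mul_left_cancel₀ hqne h2
  -- THE HEAD'S SIGN is `χ₀`
  have hsign : quadraticChar 𝓀[K] (IsLocalRing.residue 𝒪[K] ((-1) ^ m * (u₀ * u₂ * A * C))) = χ₀ := by
    have hodd : Odd m := ⟨k + 1, by omega⟩
    have e1 : IsLocalRing.residue 𝒪[K] ((-1) ^ m * (u₀ * u₂ * A * C)) = -(IsLocalRing.residue 𝒪[K] u₀ * IsLocalRing.residue 𝒪[K] u₂ * IsLocalRing.residue 𝒪[K] A * IsLocalRing.residue 𝒪[K] C) := by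
      rw [map_mul, map_pow, map_neg, map_one, hodd.neg_one_pow, neg_one_mul, map_mul, map_mul, map_mul]
    have e2 : -(IsLocalRing.residue 𝒪[K] u₀ * IsLocalRing.residue 𝒪[K] u₂ * IsLocalRing.residue 𝒪[K] (t 0) * IsLocalRing.residue 𝒪[K] (t 2)) =
        -(IsLocalRing.residue 𝒪[K] u₀ * IsLocalRing.residue 𝒪[K] u₂ * IsLocalRing.residue 𝒪[K] A * IsLocalRing.residue 𝒪[K] C) * (IsLocalRing.residue 𝒪[K] uinv) ^ 2 := by
      have h0 : IsLocalRing.residue 𝒪[K] (t 0) = IsLocalRing.residue 𝒪[K] A * IsLocalRing.residue 𝒪[K] uinv := by rw [show t 0 = A * uinv from rfl, map_mul]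
      have h2' : IsLocalRing.residue 𝒪[K] (t 2) = IsLocalRing.residue 𝒪[K] C * IsLocalRing.residue 𝒪[K] uinv := by rw [show t 2 = C * uinv from rfl, map_mul]
      rw [h0, h2']; ring
    rw [hχ₀, e1, e2, map_mul, quadraticChar_sq_one' huinv', mul_one]
  -- REWRITE THE COUNTS BY THE PER-LITERAL CLOSED FORMS
  have hL : (∑ b : Fin 2 × Fin 2, (-1 : ℚ) ^ (b.2 : ℕ) * ((({M : Submodule (Valued.integer K) (Fin 3 → K) |
              IsSelfDualLattice σ ϖ (Matrix.diagonal ![((ε : K)) ^ (b.1 : ℕ) * (u₀ : K), (ε : K) ^ (b.2 : ℕ) * (u₁ : K), (ε : K) ^ ((b.1 : ℕ) + (b.2 : ℕ)) * (u₂ : K)]) M ∧ mapGL T M = M ∧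
                (![-- bd : `¬ (T − 1)M ⊆ ϖM`
                    ¬ M.map ((Matrix.toLin' ((T : Matrix (Fin 3) (Fin 3) K) - 1)).restrictScalars (Valued.integer K)) ≤ scaleLattice ϖ M,
                  -- reg : depth 1, rank 2
                    M.map ((Matrix.toLin' ((T : Matrix (Fin 3) (Fin 3) K) - 1)).restrictScalars (Valued.integer K)) ≤ scaleLattice ϖ M ∧
                      ¬ M.map ((Matrix.toLin' ((T : Matrix (Fin 3) (Fin 3) K) - 1)).restrictScalars (Valued.integer K)) ≤ scaleLattice (ϖ ^ 2) M ∧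
                      ¬ M.map ((Matrix.toLin' (((T : Matrix (Fin 3) (Fin 3) K) - 1) ^ 2)).restrictScalars (Valued.integer K)) ≤ scaleLattice (ϖ ^ 3) M,
                  -- 1s : depth 1, rank 1, class `c₀`
                    M.map ((Matrix.toLin' ((T : Matrix (Fin 3) (Fin 3) K) - 1)).restrictScalars (Valued.integer K)) ≤ scaleLattice ϖ M ∧
                      ¬ M.map ((Matrix.toLin' ((T : Matrix (Fin 3) (Fin 3) K) - 1)).restrictScalars (Valued.integer K)) ≤ scaleLattice (ϖ ^ 2) M ∧
                      M.map ((Matrix.toLin' (((T : Matrix (Fin 3) (Fin 3) K) - 1) ^ 2)).restrictScalars (Valued.integer K)) ≤ scaleLattice (ϖ ^ 3) M ∧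
                      ∃ y ∈ M, ∃ a : K, Valued.v a = 1 ∧
                        Valued.v (ϖ⁻¹ * pairing σ (Matrix.diagonal ![((ε : K)) ^ (b.1 : ℕ) * (u₀ : K), (ε : K) ^ (b.2 : ℕ) * (u₁ : K), (ε : K) ^ ((b.1 : ℕ) + (b.2 : ℕ)) * (u₂ : K)]) y
                          (((T : Matrix (Fin 3) (Fin 3) K) - 1) *ᵥ y) - (c₀ : K) * a ^ 2) < 1,
                  -- 1n : depth 1, rank 1, class `c₀·ε`
                    M.map ((Matrix.toLin' ((T : Matrix (Fin 3) (Fin 3) K) - 1)).restrictScalars (Valued.integer K)) ≤ scaleLattice ϖ M ∧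
                      ¬ M.map ((Matrix.toLin' ((T : Matrix (Fin 3) (Fin 3) K) - 1)).restrictScalars (Valued.integer K)) ≤ scaleLattice (ϖ ^ 2) M ∧
                      M.map ((Matrix.toLin' (((T : Matrix (Fin 3) (Fin 3) K) - 1) ^ 2)).restrictScalars (Valued.integer K)) ≤ scaleLattice (ϖ ^ 3) M ∧
                      ∃ y ∈ M, ∃ a : K, Valued.v a = 1 ∧
                        Valued.v (ϖ⁻¹ * pairing σ (Matrix.diagonal ![((ε : K)) ^ (b.1 : ℕ) * (u₀ : K), (ε : K) ^ (b.2 : ℕ) * (u₁ : K), (ε : K) ^ ((b.1 : ℕ) + (b.2 : ℕ)) * (u₂ : K)]) y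
                          (((T : Matrix (Fin 3) (Fin 3) K) - 1) *ᵥ y) - (c₀ : K) * (ε : K) * a ^ 2) < 1,
                  -- 0 : depth ≥ 2
                    M.map ((Matrix.toLin' ((T : Matrix (Fin 3) (Fin 3) K) - 1)).restrictScalars (Valued.integer K)) ≤ scaleLattice (ϖ ^ 2) M] : Fin 5 → Prop) j}).ncard : ℕ) : ℚ)) =
      ∑ b : Fin 2 × Fin 2, (-1 : ℚ) ^ (b.2 : ℕ) * (((if IsSquare (-1 : 𝓀[K]) then
          ((![0, 0, 0, 0, 1] : Fin 5 → ℕ) + ((Fintype.card 𝓀[K]) * νE b) • (![(Fintype.card 𝓀[K]) ^ (3 * k + 3), (Fintype.card 𝓀[K]) ^ (3 * k + 2), (Fintype.card 𝓀[K]).choose 2 * (Fintype.card 𝓀[K]) ^ (2 * k) * ∑ i ∈ Finset.range k, (Fintype.card 𝓀[K]) ^ i, (Fintype.card 𝓀[K]).choose 2 * (Fintype.card 𝓀[K]) ^ (2 * k) * ∑ i ∈ Finset.range k, (Fintype.card 𝓀[K]) ^ i,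
          ∑ i ∈ Finset.range (k + 1), (Fintype.card 𝓀[K]) ^ (2 * i) + ∑ i ∈ Finset.range k, (Fintype.card 𝓀[K]) ^ (2 * k + 1 + i)] : Fin 5 → ℕ) + ((Fintype.card 𝓀[K]) * νP b) • (![0, 0, (Fintype.card 𝓀[K]) ^ (2 * k), 0, ∑ i ∈ Finset.range k, (Fintype.card 𝓀[K]) ^ (2 * i)] : Fin 5 → ℕ) + ((Fintype.card 𝓀[K]) * νM b) • (![0, 0, 0, (Fintype.card 𝓀[K]) ^ (2 * k), ∑ i ∈ Finset.range k, (Fintype.card 𝓀[K]) ^ (2 * i)] : Fin 5 → ℕ)) j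
        else
          ((![0, 0, 0, 0, 1] : Fin 5 → ℕ) + ((Fintype.card 𝓀[K]) * νE b) • (![(Fintype.card 𝓀[K]) ^ (3 * k + 3), (Fintype.card 𝓀[K]) ^ (3 * k + 2), (Fintype.card 𝓀[K]).choose 2 * (Fintype.card 𝓀[K]) ^ (2 * k) * ∑ i ∈ Finset.range k, (Fintype.card 𝓀[K]) ^ i, (Fintype.card 𝓀[K]).choose 2 * (Fintype.card 𝓀[K]) ^ (2 * k) * ∑ i ∈ Finset.range k, (Fintype.card 𝓀[K]) ^ i,
          ∑ i ∈ Finset.range (k + 1), (Fintype.card 𝓀[K]) ^ (2 * i) + ∑ i ∈ Finset.range k, (Fintype.card 𝓀[K]) ^ (2 * k + 1 + i)] : Fin 5 → ℕ) + ((Fintype.card 𝓀[K]) * νP b) • (![0, 0, if Even k then (Fintype.card 𝓀[K]) ^ (2 * k) else 0, if Even k then 0 else (Fintype.card 𝓀[K]) ^ (2 * k), ∑ i ∈ Finset.range k, (Fintype.card 𝓀[K]) ^ (2 * i)] : Fin 5 → ℕ) + ((Fintype.card 𝓀[K]) * νM b) • (![0, 0, if Even k then 0 else (Fintype.card 𝓀[K])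 ^ (2 * k), if Even k then (Fintype.card 𝓀[K]) ^ (2 * k) else 0, ∑ i ∈ Finset.range k, (Fintype.card 𝓀[K]) ^ (2 * i)] : Fin 5 → ℕ)) j) : ℕ) : ℚ) :=
    Finset.sum_congr rfl fun b _ => by rw [hcnt b]
  rw [hL, hsign, hmN, hnk, hNk]
  have hX := kappaSum_equilateral_eq (Fintype.card 𝓀[K]) k hq2 j
  have hSE' : ∑ b : Fin 2 × Fin 2, (-1 : ℚ) ^ (b.2 : ℕ) * (νE b : ℚ) = 4 * (χ₀ : ℚ) := by exact_mod_cast hSE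
  have hSP' : ∑ b : Fin 2 × Fin 2, (-1 : ℚ) ^ (b.2 : ℕ) * (νP b : ℚ) = -2 * (χ₀ : ℚ) := by exact_mod_cast hSP
  have hSM' : ∑ b : Fin 2 × Fin 2, (-1 : ℚ) ^ (b.2 : ℕ) * (νM b : ℚ) = -2 * (χ₀ : ℚ) := by exact_mod_cast hSM
  by_cases hsq : IsSquare (-1 : 𝓀[K])
  · simp only [if_pos hsq]
    set q : ℕ := Fintype.card 𝓀[K] with hq
    set V4 : Fin 5 → ℕ := ![0, 0, 0, 0, 1] with hV4
    set VE : Fin 5 → ℕ := ![q ^ (3 * k + 3), q ^ (3 * k + 2), q.choose 2 * q ^ (2 * k) * ∑ i ∈ Finset.range k, q ^ i, q.choose 2 * q ^ (2 * k) * ∑ i ∈ Finset.range k, q ^ i,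
          ∑ i ∈ Finset.range (k + 1), q ^ (2 * i) + ∑ i ∈ Finset.range k, q ^ (2 * k + 1 + i)] with hVE
    set VP : Fin 5 → ℕ := ![0, 0, q ^ (2 * k), 0, ∑ i ∈ Finset.range k, q ^ (2 * i)] with hVP
    set VM : Fin 5 → ℕ := ![0, 0, 0, q ^ (2 * k), ∑ i ∈ Finset.range k, q ^ (2 * i)] with hVM
    set VS : Fin 5 → ℕ := ![0, 0, q ^ (2 * k), q ^ (2 * k), 2 * ∑ i ∈ Finset.range k, q ^ (2 * i)] with hVS
    set X : Fin 5 → ℚ := ![4 * (q : ℚ) ^ (k + 1), 4 * (q : ℚ) ^ (k + 1 - 1), (2 * ((q : ℚ) ^ (k + 1) - q - 1)) / (q : ℚ) ^ 2, (2 * ((q : ℚ) ^ (k + 1) - q - 1)) / (q : ℚ) ^ 2,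
            (4 * ((q : ℚ) ^ (k + 1) - 1)) / (((q : ℚ) - 1) * (q : ℚ) ^ 2)] with hXv
    have hsum : ∀ b : Fin 2 × Fin 2, (((V4 + (q * νE b) • VE + (q * νP b) • VP + (q * νM b) • VM) j : ℕ) : ℚ) =
        (V4 j : ℚ) + (q : ℚ) * (νE b : ℚ) * (VE j : ℚ) + (q : ℚ) * (νP b : ℚ) * (VP j : ℚ) + (q : ℚ) * (νM b : ℚ) * (VM j : ℚ) := by
      intro b
      simp only [Pi.add_apply, Pi.smul_apply, smul_eq_mul]
      push_cast
      ring
    simp_rw [hsum]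
    have hPM : (VP j : ℚ) + (VM j : ℚ) = (VS j : ℚ) := by
      have h := congrFun (shellSum_P_pos_add_neg_keep q k) j
      rw [Pi.add_apply] at h
      exact_mod_cast h
    simp only [Fintype.sum_prod_type, Fin.sum_univ_two, Fin.val_zero, Fin.val_one, pow_zero, pow_one, one_mul, neg_mul] at hSE' hSP' hSM' ⊢
    linear_combination ((q : ℚ) * (VE j : ℚ)) * hSE' + ((q : ℚ) * (VP j : ℚ)) * hSP' + ((q : ℚ) * (VM j : ℚ)) * hSM' + (χ₀ : ℚ) * hX -
      (2 * (q : ℚ) * (χ₀ : ℚ)) * hPM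
  · simp only [if_neg hsq]
    set q : ℕ := Fintype.card 𝓀[K] with hq
    set V4 : Fin 5 → ℕ := ![0, 0, 0, 0, 1] with hV4
    set VE : Fin 5 → ℕ := ![q ^ (3 * k + 3), q ^ (3 * k + 2), q.choose 2 * q ^ (2 * k) * ∑ i ∈ Finset.range k, q ^ i, q.choose 2 * q ^ (2 * k) * ∑ i ∈ Finset.range k, q ^ i,
          ∑ i ∈ Finset.range (k + 1), q ^ (2 * i) + ∑ i ∈ Finset.range k, q ^ (2 * k + 1 + i)] with hVE
    set VP : Fin 5 → ℕ := ![0, 0, if Even k then q ^ (2 * k) else 0, if Even k then 0 else q ^ (2 * k), ∑ i ∈ Finset.range k, q ^ (2 * i)] with hVP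
    set VM : Fin 5 → ℕ := ![0, 0, if Even k then 0 else q ^ (2 * k), if Even k then q ^ (2 * k) else 0, ∑ i ∈ Finset.range k, q ^ (2 * i)] with hVM
    set VS : Fin 5 → ℕ := ![0, 0, q ^ (2 * k), q ^ (2 * k), 2 * ∑ i ∈ Finset.range k, q ^ (2 * i)] with hVS
    set X : Fin 5 → ℚ := ![4 * (q : ℚ) ^ (k + 1), 4 * (q : ℚ) ^ (k + 1 - 1), (2 * ((q : ℚ) ^ (k + 1) - q - 1)) / (q : ℚ) ^ 2, (2 * ((q : ℚ) ^ (k + 1) - q - 1)) / (q : ℚ) ^ 2,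
            (4 * ((q : ℚ) ^ (k + 1) - 1)) / (((q : ℚ) - 1) * (q : ℚ) ^ 2)] with hXv
    have hsum : ∀ b : Fin 2 × Fin 2, (((V4 + (q * νE b) • VE + (q * νP b) • VP + (q * νM b) • VM) j : ℕ) : ℚ) =
        (V4 j : ℚ) + (q : ℚ) * (νE b : ℚ) * (VE j : ℚ) + (q : ℚ) * (νP b : ℚ) * (VP j : ℚ) + (q : ℚ) * (νM b : ℚ) * (VM j : ℚ) := by
      intro b
      simp only [Pi.add_apply, Pi.smul_apply, smul_eq_mul]
      push_cast
      ring
    simp_rw [hsum]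
    have hPM : (VP j : ℚ) + (VM j : ℚ) = (VS j : ℚ) := by
      have h := congrFun (shellSum_P_pos_add_neg_flip q k) j
      rw [Pi.add_apply] at h
      exact_mod_cast h
    simp only [Fintype.sum_prod_type, Fin.sum_univ_two, Fin.val_zero, Fin.val_one, pow_zero, pow_one, one_mul, neg_mul] at hSE' hSP' hSM' ⊢
    linear_combination ((q : ℚ) * (VE j : ℚ)) * hSE' + ((q : ℚ) * (VP j : ℚ)) * hSP' + ((q : ℚ) * (VM j : ℚ)) * hSM' + (χ₀ : ℚ) * hX -
      (2 * (q : ℚ) * (χ₀ : ℚ)) * hPM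


end Literature.NumberTheory.Rogawski1990

end
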